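import Literature.Barriers.CriticalPhenomena.WeaklySAWFiniteVolume
import Mathlib.Analysis.Calculus.IteratedDeriv.Defs
import HarnessLib

/-!
# BBS 2015, Lemma 2.1 (second half): `χ_N`, `χ` and all their `ν`-derivatives above `ν_c`;
# `χ_N^{(j)} → χ^{(j)}` uniformly on `[a, ∞)`, `a > ν_c`

Companion (theorems only) to `WeaklySAWFiniteVolume.lean` (Bauerschmidt–Brydges–Slade, CMP 337
(2015), arXiv:1403.7422, §2: the torus susceptibility `torusSusceptibility d n g ν = χ_N(ν)`,
`torusSurvival = c_{N,T} ≤ c_T = survival`, `c_{N,T} → c_T`, `χ_N ↑ χ` in `[0,∞]`) and to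
`WeaklySAWFourDimLogCorrectionsLemma21.lean` (`χ` finite and differentiable above `ν_c`).

Lemma 2.1 of the source ends: "The functions `χ_N` and `χ` are analytic on `{ν ∈ ℂ : Re ν > ν_c}`,
and `χ_N` and all its derivatives converge uniformly on compact subsets of `Re ν > ν_c` to `χ` and
its derivatives" (proof: "`|c_{N,T}e^{-νT}| ≤ c_T e^{-(Re ν)T}` … dominated convergence …
analyticity of Laplace transforms … Montel's theorem"). This file proves the REAL-VARIABLE content
of that clause — which is what the paper uses (last display of §4.1: `∂χ/∂ν` as the limit of finite-volume
derivatives; §8.4) — by the real method (differentiation under the integral sign and dominated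
convergence, no complex analysis):

* general Laplace-transform calculus for a measurable `0 ≤ h` with `∫₀^∞ h e^{-ν₁T} dT < ∞`
  (`pow_mul_exp_neg_mul_le`: `T^k e^{-ηT} ≤ k!/η^k`; `integrableOn_pow_mul_laplace`;
  **`hasDerivAt_laplaceMoment`**: `d/dν ∫T^k h e^{-νT} = -∫T^{k+1} h e^{-νT}` for `ν > ν₁`;
  **`iteratedDeriv_laplace`**: `(d/dν)^j ∫ h e^{-νT} = (-1)^j ∫ T^j h e^{-νT}`; for `0 ≤ h_n ≤ h` with
  `h_n → h` pointwise: **`tendsto_laplaceMoment`** (dominated convergence of all moments),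
  `laplaceMoment_sub_le` and **`tendstoUniformlyOn_laplaceMoment`** (the deficits
  `∫T^k(h-h_n)e^{-νT} ≥ 0` decrease in `ν`, so convergence is uniform on `[a,∞)`, `a > ν₁`));
* for the walk (`g ≥ 0`, `ν > ν_c(g)`): `torusSusceptibility_toReal_eq_integral`,
  `integrableOn_torusSurvival_mul_exp`, `hasDerivAt_susceptibilityMoment`,
  `hasDerivAt_torusSusceptibilityMoment`, **`iteratedDeriv_susceptibility_toReal`** and
  **`iteratedDeriv_torusSusceptibility_toReal`** (`χ^{(j)}(ν) = (-1)^j∫₀^∞ T^j c_T e^{-νT}dT`, same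
  for `χ_N`: both are `C^∞` on `(ν_c,∞)` with these derivatives),
  **`tendsto_iteratedDeriv_torusSusceptibility`** (`χ_N^{(j)}(ν) → χ^{(j)}(ν)`),
  **`tendstoUniformlyOn_iteratedDeriv_torusSusceptibility`** (uniformly on `[a,∞)` for every
  `a > ν_c`, hence on compact subsets of `(ν_c,∞)`), and the first-order forms
  `hasDerivAt_torusSusceptibility_toReal`, `tendsto_deriv_torusSusceptibility`,
  `tendsto_torusSusceptibility_toReal`.

Not covered (and not used downstream in the source): complex `ν` / analyticity proper.
-/

noncomputable section

open MeasureTheory Filter Topology Set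
open Literature.Probability.LatticeModels
open scoped ENNReal BigOperators Nat

namespace Literature.Barriers.CriticalPhenomena

namespace CTWSAW

variable {d : ℕ}

/-! ### Laplace transforms of bounded non-negative functions: moments, derivatives, limits -/

section Laplace

/-- `T^k e^{-ηT} ≤ k!/η^k` for `T ≥ 0`, `η > 0` (from `(ηT)^k/k! ≤ e^{ηT}`). [folklore] -/
theorem pow_mul_exp_neg_mul_le {η : ℝ} (hη : 0 < η) (k : ℕ) {T : ℝ} (hT : 0 ≤ T) :
    T ^ k * Real.exp (-η * T) ≤ k ! / η ^ k := by
  have h1 := Real.pow_div_factorial_le_exp (η * T) (by positivity) k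
  have h2 : (η * T) ^ k ≤ Real.exp (η * T) * k ! := (div_le_iff₀ (by positivity)).1 h1
  have hexp : 0 < Real.exp (η * T) := Real.exp_pos _
  have hηk : 0 < η ^ k := by positivity
  rw [le_div_iff₀ hηk, show -η * T = -(η * T) by ring, Real.exp_neg]
  rw [mul_pow] at h2
  calc T ^ k * (Real.exp (η * T))⁻¹ * η ^ k
      = (η ^ k * T ^ k) * (Real.exp (η * T))⁻¹ := by ring
    _ ≤ (Real.exp (η * T) * k !) * (Real.exp (η * T))⁻¹ :=
        mul_le_mul_of_nonneg_right h2 (inv_pos.2 hexp).le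
    _ = k ! := by field_simp

variable {h : ℝ → ℝ}

/-- Moments of a Laplace transform: if `h ≥ 0` is measurable with `∫₀^∞ h e^{-ν₁T} < ∞`, then
`T^k h(T) e^{-νT}` is integrable on `(0,∞)` for every `ν > ν₁` and `k`. [folklore] -/
theorem integrableOn_pow_mul_laplace (hmeas : Measurable h) (hnn : ∀ T, 0 ≤ h T) {ν₁ ν : ℝ}
    (hlt : ν₁ < ν) (hint : IntegrableOn (fun T => h T * Real.exp (-ν₁ * T)) (Ioi 0)) (k : ℕ) :
    IntegrableOn (fun T => T ^ k * (h T * Real.exp (-ν * T))) (Ioi 0) := by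
  have hη : 0 < ν - ν₁ := sub_pos.2 hlt
  refine Integrable.mono' (hint.const_mul (k ! / (ν - ν₁) ^ k)) ?_ ?_
  · have hm : Measurable fun T => T ^ k * (h T * Real.exp (-ν * T)) := by fun_prop
    exact hm.aestronglyMeasurable
  · refine (ae_restrict_mem measurableSet_Ioi).mono fun T hT => ?_
    have hT : 0 < T := hT
    have h0 : 0 ≤ h T := hnn T
    rw [Real.norm_eq_abs, abs_of_nonneg (by positivity)]
    have hsplit : T ^ k * (h T * Real.exp (-ν * T)) =
        (T ^ k * Real.exp (-(ν - ν₁) * T)) * (h T * Real.exp (-ν₁ * T)) := by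
      rw [show -ν * T = -(ν - ν₁) * T + -ν₁ * T by ring, Real.exp_add]; ring
    rw [hsplit]
    exact mul_le_mul_of_nonneg_right (pow_mul_exp_neg_mul_le hη k hT.le) (by positivity)

/-- **Differentiation of Laplace moments under the integral sign**: for `h ≥ 0` measurable with
`∫₀^∞ h e^{-ν₁T} dT < ∞` and `ν > ν₁`,
`d/dν ∫₀^∞ T^k h(T) e^{-νT} dT = -∫₀^∞ T^{k+1} h(T) e^{-νT} dT` ("analyticity of Laplace
transforms", real form). [folklore] -/
theorem hasDerivAt_laplaceMoment (hmeas : Measurable h) (hnn : ∀ T, 0 ≤ h T) {ν₁ ν : ℝ}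
    (hlt : ν₁ < ν) (hint : IntegrableOn (fun T => h T * Real.exp (-ν₁ * T)) (Ioi 0)) (k : ℕ) :
    HasDerivAt (fun ν' => ∫ T in Ioi (0 : ℝ), T ^ k * (h T * Real.exp (-ν' * T)))
      (-∫ T in Ioi (0 : ℝ), T ^ (k + 1) * (h T * Real.exp (-ν * T))) ν := by
  set η : ℝ := (ν - ν₁) / 2 with hη
  have hηpos : 0 < η := by rw [hη]; linarith
  have hF_meas : ∀ ν' : ℝ, AEStronglyMeasurable (fun T => T ^ k * (h T * Real.exp (-ν' * T)))
      (volume.restrict (Ioi 0)) := fun ν' => by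
    have hm : Measurable fun T => T ^ k * (h T * Real.exp (-ν' * T)) := by fun_prop
    exact hm.aestronglyMeasurable
  have hF'_meas : AEStronglyMeasurable (fun T => -(T ^ (k + 1) * (h T * Real.exp (-ν * T))))
      (volume.restrict (Ioi 0)) := by
    have hm : Measurable fun T => -(T ^ (k + 1) * (h T * Real.exp (-ν * T))) := by fun_prop
    exact hm.aestronglyMeasurable
  have hkey := hasDerivAt_integral_of_dominated_loc_of_deriv_le
    (μ := volume.restrict (Ioi (0 : ℝ))) (x₀ := ν) (s := Metric.ball ν η)
    (F := fun ν' T => T ^ k * (h T * Real.exp (-ν' * T)))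
    (F' := fun ν' T => -(T ^ (k + 1) * (h T * Real.exp (-ν' * T))))
    (bound := fun T => ((k + 1)! / η ^ (k + 1)) * (h T * Real.exp (-ν₁ * T)))
    (Metric.ball_mem_nhds ν hηpos) (Eventually.of_forall hF_meas)
    (integrableOn_pow_mul_laplace hmeas hnn hlt hint k) hF'_meas ?_ (hint.const_mul _) ?_
  · have h2 := hkey.2
    rw [integral_neg] at h2
    exact h2
  · refine (ae_restrict_mem measurableSet_Ioi).mono fun T hT ν' hν' => ?_
    have hT : 0 < T := hT
    have h0 : 0 ≤ h T := hnn T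
    have hν'lt : ν₁ + η < ν' := by
      have h1 := Metric.mem_ball.1 hν'
      rw [Real.dist_eq] at h1
      have h2 := (abs_lt.1 h1).1
      rw [hη] at h2 ⊢
      linarith
    rw [norm_neg, Real.norm_eq_abs, abs_of_nonneg (by positivity)]
    have hexp : Real.exp (-ν' * T) ≤ Real.exp (-η * T) * Real.exp (-ν₁ * T) := by
      rw [← Real.exp_add]
      exact Real.exp_le_exp.2 (by nlinarith)
    calc T ^ (k + 1) * (h T * Real.exp (-ν' * T))
        ≤ T ^ (k + 1) * (h T * (Real.exp (-η * T) * Real.exp (-ν₁ * T))) := by gcongr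
      _ = (T ^ (k + 1) * Real.exp (-η * T)) * (h T * Real.exp (-ν₁ * T)) := by ring
      _ ≤ ((k + 1)! / η ^ (k + 1)) * (h T * Real.exp (-ν₁ * T)) :=
          mul_le_mul_of_nonneg_right (pow_mul_exp_neg_mul_le hηpos (k + 1) hT.le) (by positivity)
  · refine Eventually.of_forall fun T ν' _ => ?_
    have h1 : HasDerivAt (fun ν' : ℝ => -ν' * T) (-T) ν' := by
      simpa using ((hasDerivAt_id ν').neg.mul_const T)
    have h2 := (h1.exp).const_mul (T ^ k * h T)
    have hfun : (fun ν'' : ℝ => T ^ k * (h T * Real.exp (-ν'' * T))) =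
        fun ν'' => T ^ k * h T * Real.exp (-ν'' * T) := by
      funext ν''; ring
    rw [hfun]
    exact h2.congr_deriv (by ring)

/-- **All derivatives of a Laplace transform**: under the hypotheses of `hasDerivAt_laplaceMoment`,
for `ν > ν₁`, `(d/dν)^j ∫₀^∞ h e^{-νT} dT = (-1)^j ∫₀^∞ T^j h(T) e^{-νT} dT`. [folklore] -/
theorem iteratedDeriv_laplace (hmeas : Measurable h) (hnn : ∀ T, 0 ≤ h T) {ν₁ : ℝ}
    (hint : IntegrableOn (fun T => h T * Real.exp (-ν₁ * T)) (Ioi 0)) (j : ℕ) {ν : ℝ}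
    (hlt : ν₁ < ν) :
    iteratedDeriv j (fun ν' => ∫ T in Ioi (0 : ℝ), h T * Real.exp (-ν' * T)) ν
      = (-1) ^ j * ∫ T in Ioi (0 : ℝ), T ^ j * (h T * Real.exp (-ν * T)) := by
  induction j generalizing ν with
  | zero => simp
  | succ j ih =>
    rw [iteratedDeriv_succ]
    have hev : iteratedDeriv j (fun ν' => ∫ T in Ioi (0 : ℝ), h T * Real.exp (-ν' * T))
        =ᶠ[𝓝 ν] fun ν' => (-1) ^ j * ∫ T in Ioi (0 : ℝ), T ^ j * (h T * Real.exp (-ν' * T)) :=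
      eventually_of_mem (Ioi_mem_nhds hlt) fun ν' hν' => ih hν'
    rw [hev.deriv_eq, ((hasDerivAt_laplaceMoment hmeas hnn hlt hint j).const_mul ((-1) ^ j)).deriv]
    ring

variable {hn : ℕ → ℝ → ℝ}

/-- **Convergence of Laplace moments** (dominated convergence): if `0 ≤ h_n ≤ h` are measurable,
`h_n(T) → h(T)` for `T > 0`, and `∫₀^∞ h e^{-ν₁T} < ∞`, then for `ν > ν₁` and every `k`,
`∫₀^∞ T^k h_n e^{-νT} → ∫₀^∞ T^k h e^{-νT}`. [folklore] -/
theorem tendsto_laplaceMoment (hmeasn : ∀ n, Measurable (hn n)) (h0 : ∀ n T, 0 ≤ hn n T)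
    (hle : ∀ n T, hn n T ≤ h T) {ν₁ ν : ℝ} (hlt : ν₁ < ν)
    (hint : IntegrableOn (fun T => h T * Real.exp (-ν₁ * T)) (Ioi 0))
    (hlim : ∀ T, 0 < T → Tendsto (fun n => hn n T) atTop (𝓝 (h T))) (k : ℕ) :
    Tendsto (fun n => ∫ T in Ioi (0 : ℝ), T ^ k * (hn n T * Real.exp (-ν * T))) atTop
      (𝓝 (∫ T in Ioi (0 : ℝ), T ^ k * (h T * Real.exp (-ν * T)))) := by
  have hnn : ∀ T, 0 ≤ h T := fun T => (h0 0 T).trans (hle 0 T)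
  have hη : 0 < ν - ν₁ := sub_pos.2 hlt
  refine tendsto_integral_of_dominated_convergence
    (fun T => (k ! / (ν - ν₁) ^ k) * (h T * Real.exp (-ν₁ * T))) (fun n => ?_)
    (hint.const_mul _) (fun n => ?_) ?_
  · have hm : Measurable fun T => T ^ k * (hn n T * Real.exp (-ν * T)) := by
      have := hmeasn n; fun_prop
    exact hm.aestronglyMeasurable
  · refine (ae_restrict_mem measurableSet_Ioi).mono fun T hT => ?_
    have hT : 0 < T := hT
    have h0' : 0 ≤ hn n T := h0 n T
    rw [Real.norm_eq_abs, abs_of_nonneg (by positivity)]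
    have hsplit : T ^ k * (h T * Real.exp (-ν * T)) =
        (T ^ k * Real.exp (-(ν - ν₁) * T)) * (h T * Real.exp (-ν₁ * T)) := by
      rw [show -ν * T = -(ν - ν₁) * T + -ν₁ * T by ring, Real.exp_add]; ring
    calc T ^ k * (hn n T * Real.exp (-ν * T)) ≤ T ^ k * (h T * Real.exp (-ν * T)) := by
          gcongr; exact hle n T
      _ = (T ^ k * Real.exp (-(ν - ν₁) * T)) * (h T * Real.exp (-ν₁ * T)) := hsplit
      _ ≤ (k ! / (ν - ν₁) ^ k) * (h T * Real.exp (-ν₁ * T)) :=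
          mul_le_mul_of_nonneg_right (pow_mul_exp_neg_mul_le hη k hT.le)
            (mul_nonneg (hnn T) (Real.exp_pos _).le)
  · refine (ae_restrict_mem measurableSet_Ioi).mono fun T hT => ?_
    exact ((hlim T hT).mul_const _).const_mul _

/-- Monotonicity in `ν` of the moment deficits: for `a ≤ ν` (both `> ν₁`) and `0 ≤ h_n ≤ h`,
`0 ≤ ∫T^k(h - h_n)e^{-νT} ≤ ∫T^k(h - h_n)e^{-aT}`, written with the four (finite) moments.
[folklore] -/
theorem laplaceMoment_sub_le (hmeasn : ∀ n, Measurable (hn n)) (h0 : ∀ n T, 0 ≤ hn n T)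
    (hle : ∀ n T, hn n T ≤ h T) (hmeas : Measurable h) {ν₁ a ν : ℝ} (hlt : ν₁ < a) (haν : a ≤ ν)
    (hint : IntegrableOn (fun T => h T * Real.exp (-ν₁ * T)) (Ioi 0)) (k n : ℕ) :
    0 ≤ (∫ T in Ioi (0 : ℝ), T ^ k * (h T * Real.exp (-ν * T))) -
        ∫ T in Ioi (0 : ℝ), T ^ k * (hn n T * Real.exp (-ν * T)) ∧
      (∫ T in Ioi (0 : ℝ), T ^ k * (h T * Real.exp (-ν * T))) -
          ∫ T in Ioi (0 : ℝ), T ^ k * (hn n T * Real.exp (-ν * T)) ≤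
        (∫ T in Ioi (0 : ℝ), T ^ k * (h T * Real.exp (-a * T))) -
          ∫ T in Ioi (0 : ℝ), T ^ k * (hn n T * Real.exp (-a * T)) := by
  have hnn : ∀ T, 0 ≤ h T := fun T => (h0 0 T).trans (hle 0 T)
  have hνlt : ν₁ < ν := hlt.trans_le haν
  -- integrability of the four moments
  have hI : ∀ {μ' : ℝ}, ν₁ < μ' →
      IntegrableOn (fun T => T ^ k * (h T * Real.exp (-μ' * T))) (Ioi 0) := fun hμ' =>
    integrableOn_pow_mul_laplace hmeas hnn hμ' hint k
  have hIn : ∀ {μ' : ℝ}, ν₁ < μ' →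
      IntegrableOn (fun T => T ^ k * (hn n T * Real.exp (-μ' * T))) (Ioi 0) := by
    intro μ' hμ'
    refine Integrable.mono' (hI hμ') ?_ ?_
    · have hm : Measurable fun T => T ^ k * (hn n T * Real.exp (-μ' * T)) := by
        have := hmeasn n; fun_prop
      exact hm.aestronglyMeasurable
    · refine (ae_restrict_mem measurableSet_Ioi).mono fun T hT => ?_
      have hT : 0 < T := hT
      have h0' : 0 ≤ hn n T := h0 n T
      rw [Real.norm_eq_abs, abs_of_nonneg (by positivity)]
      gcongr
      exact hle n T
  have hsub : ∀ {μ' : ℝ}, ν₁ < μ' →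
      (∫ T in Ioi (0 : ℝ), T ^ k * (h T * Real.exp (-μ' * T))) -
          ∫ T in Ioi (0 : ℝ), T ^ k * (hn n T * Real.exp (-μ' * T)) =
        ∫ T in Ioi (0 : ℝ), T ^ k * ((h T - hn n T) * Real.exp (-μ' * T)) := by
    intro μ' hμ'
    rw [← integral_sub (hI hμ') (hIn hμ')]
    refine integral_congr_ae (Eventually.of_forall fun T => ?_)
    simp only; ring
  have hId : ∀ {μ' : ℝ}, ν₁ < μ' →
      IntegrableOn (fun T => T ^ k * ((h T - hn n T) * Real.exp (-μ' * T))) (Ioi 0) := by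
    intro μ' hμ'
    have := (hI hμ').sub (hIn hμ')
    refine this.congr (Eventually.of_forall fun T => ?_)
    simp only [Pi.sub_apply]; ring
  rw [hsub hνlt, hsub hlt]
  constructor
  · refine setIntegral_nonneg measurableSet_Ioi fun T hT => ?_
    have hT : 0 < T := hT
    have : 0 ≤ h T - hn n T := sub_nonneg.2 (hle n T)
    positivity
  · refine setIntegral_mono_on (hId hνlt) (hId hlt) measurableSet_Ioi fun T hT => ?_
    have hT : 0 < T := hT
    have : 0 ≤ h T - hn n T := sub_nonneg.2 (hle n T)
    have hexp : Real.exp (-ν * T) ≤ Real.exp (-a * T) := Real.exp_le_exp.2 (by nlinarith)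
    gcongr

/-- **Uniform convergence of Laplace moments on `[a, ∞)`** (`a > ν₁`): since the deficits
`∫T^k(h - h_n)e^{-νT} ≥ 0` decrease in `ν`, pointwise convergence at `ν = a` is uniform on `[a,∞)`.
[folklore] -/
theorem tendstoUniformlyOn_laplaceMoment (hmeasn : ∀ n, Measurable (hn n)) (h0 : ∀ n T, 0 ≤ hn n T)
    (hle : ∀ n T, hn n T ≤ h T) (hmeas : Measurable h) {ν₁ a : ℝ} (hlt : ν₁ < a)
    (hint : IntegrableOn (fun T => h T * Real.exp (-ν₁ * T)) (Ioi 0))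
    (hlim : ∀ T, 0 < T → Tendsto (fun n => hn n T) atTop (𝓝 (h T))) (k : ℕ) :
    TendstoUniformlyOn (fun n ν => ∫ T in Ioi (0 : ℝ), T ^ k * (hn n T * Real.exp (-ν * T)))
      (fun ν => ∫ T in Ioi (0 : ℝ), T ^ k * (h T * Real.exp (-ν * T))) atTop (Ici a) := by
  rw [Metric.tendstoUniformlyOn_iff]
  intro ε hε
  have ha := tendsto_laplaceMoment hmeasn h0 hle hlt hint hlim k
  rw [Metric.tendsto_nhds] at ha
  filter_upwards [ha ε hε] with n hn' ν hν
  have h1 := laplaceMoment_sub_le hmeasn h0 hle hmeas hlt (mem_Ici.1 hν) hint k n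
  have h2 := laplaceMoment_sub_le hmeasn h0 hle hmeas hlt le_rfl hint k n
  rw [Real.dist_eq, abs_of_nonneg h1.1]
  rw [Real.dist_eq, abs_sub_comm, abs_of_nonneg h2.1] at hn'
  exact h1.2.trans_lt hn'

end Laplace


/-! ### `χ_N` and `χ` as real Laplace transforms of `c_{N,T} ≤ c_T` -/

/-- `χ_N(ν)` as a real number is the Bochner integral `∫_{T>0} c_{N,T} e^{-νT} dT` (`g ≥ 0`; both
sides vanish when `χ_N = ∞`). [cite: BauerschmidtBrydgesSlade2015LogCorr, §2 (definition of χ_N)] -/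
theorem torusSusceptibility_toReal_eq_integral (n : ℕ) {g : ℝ} (hg : 0 ≤ g) (ν : ℝ) :
    (torusSusceptibility d n g ν).toReal =
      ∫ T in Ioi (0 : ℝ), (torusSurvival d n g T).toReal * Real.exp (-ν * T) := by
  rw [integral_eq_lintegral_of_nonneg_ae]
  · congr 1
    unfold torusSusceptibility
    refine setLIntegral_congr_fun measurableSet_Ioi fun T hT => ?_
    rw [ENNReal.ofReal_mul ENNReal.toReal_nonneg,
      ENNReal.ofReal_toReal ((torusSurvival_le_one n hg hT).trans_lt ENNReal.one_lt_top).ne]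
  · exact Eventually.of_forall fun T => mul_nonneg ENNReal.toReal_nonneg (Real.exp_pos _).le
  · have hm : Measurable fun T => (torusSurvival d n g T).toReal * Real.exp (-ν * T) :=
      (measurable_torusSurvival d n g).ennreal_toReal.mul
        (Real.continuous_exp.comp (continuous_const.mul continuous_id)).measurable
    exact hm.aestronglyMeasurable

/-- `c_T < ∞` for every `T` (`≤ 1` for `T > 0`, `= 0` for `T ≤ 0`; `g ≥ 0`). [folklore] -/
theorem survival_ne_top {g : ℝ} (hg : 0 ≤ g) (T : ℝ) : survival d g T ≠ ∞ := by
  rcases le_or_gt T 0 with hT | hT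
  · rw [survival_of_nonpos g hT]; exact ENNReal.zero_ne_top
  · exact ((survival_le_one hg d hT).trans_lt ENNReal.one_lt_top).ne

/-- `c_{N,T} ≤ c_T` as real numbers (`g ≥ 0`). [cite: BauerschmidtBrydgesSlade2015LogCorr, §2, proof of Lemma 2.1 (display `c_{N,T} ≤ c_{N+1,T} ≤ c_T`)] -/
theorem torusSurvival_toReal_le (n : ℕ) {g : ℝ} (hg : 0 ≤ g) (T : ℝ) :
    (torusSurvival d n g T).toReal ≤ (survival d g T).toReal :=
  ENNReal.toReal_mono (survival_ne_top hg T) (torusSurvival_le_survival n hg T)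

/-- `c_{N,T} → c_T` as real numbers (`g ≥ 0`). [cite: BauerschmidtBrydgesSlade2015LogCorr, §2, proof of Lemma 2.1 (display `lim_{N→∞} c_{N,T} = c_T`)] -/
theorem tendsto_torusSurvival_toReal {g : ℝ} (hg : 0 ≤ g) (T : ℝ) :
    Tendsto (fun n => (torusSurvival d n g T).toReal) atTop (𝓝 (survival d g T).toReal) :=
  (ENNReal.tendsto_toReal (survival_ne_top hg T)).comp (tendsto_torusSurvival hg T)

/-- Integrability of `c_{N,T} e^{-νT}` on `(0,∞)` for `ν > ν_c` (`g ≥ 0`; dominated by `c_T e^{-νT}`).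
[cite: BauerschmidtBrydgesSlade2015LogCorr, §2, proof of Lemma 2.1 ("|c_{N,T}e^{-νT}| ≤ c_T e^{-(Re ν)T}")] -/
theorem integrableOn_torusSurvival_mul_exp (n : ℕ) {g : ℝ} (hg : 0 ≤ g) {ν : ℝ}
    (hν : criticalNu d g < ν) :
    IntegrableOn (fun T => (torusSurvival d n g T).toReal * Real.exp (-ν * T)) (Ioi 0) := by
  refine Integrable.mono' (integrableOn_survival_mul_exp hg hν) ?_ ?_
  · have hm : Measurable fun T => (torusSurvival d n g T).toReal * Real.exp (-ν * T) :=
      (measurable_torusSurvival d n g).ennreal_toReal.mul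
        (Real.continuous_exp.comp (continuous_const.mul continuous_id)).measurable
    exact hm.aestronglyMeasurable
  · refine Eventually.of_forall fun T => ?_
    rw [Real.norm_eq_abs, abs_of_nonneg (mul_nonneg ENNReal.toReal_nonneg (Real.exp_pos _).le)]
    exact mul_le_mul_of_nonneg_right (torusSurvival_toReal_le n hg T) (Real.exp_pos _).le

/-! ### Lemma 2.1, second half: all `ν`-derivatives of `χ_N` and `χ` above `ν_c`, and their convergence -/

/-- **Lemma 2.1 (smoothness of `χ` above `ν_c`, real form of "`χ` is analytic on `Re ν > ν_c`")**:
for `g ≥ 0`, `ν > ν_c` and every `k`, the `k`-th Laplace moment `ν' ↦ ∫₀^∞ T^k c_T e^{-ν'T} dT`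
has derivative `-∫₀^∞ T^{k+1} c_T e^{-νT} dT` at `ν`.
[cite: BauerschmidtBrydgesSlade2015LogCorr, Lemma 2.1 ("analyticity of Laplace transforms")] -/
theorem hasDerivAt_susceptibilityMoment {g : ℝ} (hg : 0 ≤ g) {ν : ℝ} (hν : criticalNu d g < ν)
    (k : ℕ) :
    HasDerivAt (fun ν' => ∫ T in Ioi (0 : ℝ), T ^ k * ((survival d g T).toReal * Real.exp (-ν' * T)))
      (-∫ T in Ioi (0 : ℝ), T ^ (k + 1) * ((survival d g T).toReal * Real.exp (-ν * T))) ν := by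
  have h1 : criticalNu d g < (criticalNu d g + ν) / 2 := by linarith
  have h2 : (criticalNu d g + ν) / 2 < ν := by linarith
  exact hasDerivAt_laplaceMoment (measurable_survival d g).ennreal_toReal
    (fun _ => ENNReal.toReal_nonneg) h2 (integrableOn_survival_mul_exp hg h1) k

/-- **Lemma 2.1 (smoothness of `χ_N` above `ν_c`)**: the same for the torus, `g ≥ 0`, `ν > ν_c`.
[cite: BauerschmidtBrydgesSlade2015LogCorr, Lemma 2.1 ("the functions χ_N and χ are analytic on Re ν > ν_c")] -/
theorem hasDerivAt_torusSusceptibilityMoment (n : ℕ) {g : ℝ} (hg : 0 ≤ g) {ν : ℝ}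
    (hν : criticalNu d g < ν) (k : ℕ) :
    HasDerivAt
      (fun ν' => ∫ T in Ioi (0 : ℝ), T ^ k * ((torusSurvival d n g T).toReal * Real.exp (-ν' * T)))
      (-∫ T in Ioi (0 : ℝ), T ^ (k + 1) * ((torusSurvival d n g T).toReal * Real.exp (-ν * T)))
      ν := by
  have h1 : criticalNu d g < (criticalNu d g + ν) / 2 := by linarith
  have h2 : (criticalNu d g + ν) / 2 < ν := by linarith
  exact hasDerivAt_laplaceMoment (measurable_torusSurvival d n g).ennreal_toReal
    (fun _ => ENNReal.toReal_nonneg) h2 (integrableOn_torusSurvival_mul_exp n hg h1) k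

/-- **All derivatives of `χ` above `ν_c`**: `χ^{(j)}(ν) = (-1)^j ∫₀^∞ T^j c_T e^{-νT} dT`
(`g ≥ 0`, `ν > ν_c`). [cite: BauerschmidtBrydgesSlade2015LogCorr, Lemma 2.1 (χ analytic on Re ν > ν_c)] -/
theorem iteratedDeriv_susceptibility_toReal {g : ℝ} (hg : 0 ≤ g) {ν : ℝ} (hν : criticalNu d g < ν)
    (j : ℕ) :
    iteratedDeriv j (fun ν' => (susceptibility d g ν').toReal) ν =
      (-1) ^ j * ∫ T in Ioi (0 : ℝ), T ^ j * ((survival d g T).toReal * Real.exp (-ν * T)) := by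
  have hfun : (fun ν' => (susceptibility d g ν').toReal) =
      fun ν' => ∫ T in Ioi (0 : ℝ), (survival d g T).toReal * Real.exp (-ν' * T) :=
    funext fun ν' => susceptibility_toReal_eq_integral hg d ν'
  rw [hfun]
  have h1 : criticalNu d g < (criticalNu d g + ν) / 2 := by linarith
  have h2 : (criticalNu d g + ν) / 2 < ν := by linarith
  exact iteratedDeriv_laplace (measurable_survival d g).ennreal_toReal
    (fun _ => ENNReal.toReal_nonneg) (integrableOn_survival_mul_exp hg h1) j h2

/-- **All derivatives of `χ_N` above `ν_c`**: `χ_N^{(j)}(ν) = (-1)^j ∫₀^∞ T^j c_{N,T} e^{-νT} dT`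
(`g ≥ 0`, `ν > ν_c`). [cite: BauerschmidtBrydgesSlade2015LogCorr, Lemma 2.1 (χ_N analytic on Re ν > ν_c)] -/
theorem iteratedDeriv_torusSusceptibility_toReal (n : ℕ) {g : ℝ} (hg : 0 ≤ g) {ν : ℝ}
    (hν : criticalNu d g < ν) (j : ℕ) :
    iteratedDeriv j (fun ν' => (torusSusceptibility d n g ν').toReal) ν =
      (-1) ^ j * ∫ T in Ioi (0 : ℝ), T ^ j * ((torusSurvival d n g T).toReal * Real.exp (-ν * T)) := by
  have hfun : (fun ν' => (torusSusceptibility d n g ν').toReal) =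
      fun ν' => ∫ T in Ioi (0 : ℝ), (torusSurvival d n g T).toReal * Real.exp (-ν' * T) :=
    funext fun ν' => torusSusceptibility_toReal_eq_integral n hg ν'
  rw [hfun]
  have h1 : criticalNu d g < (criticalNu d g + ν) / 2 := by linarith
  have h2 : (criticalNu d g + ν) / 2 < ν := by linarith
  exact iteratedDeriv_laplace (measurable_torusSurvival d n g).ennreal_toReal
    (fun _ => ENNReal.toReal_nonneg) (integrableOn_torusSurvival_mul_exp n hg h1) j h2

/-- **Lemma 2.1 (convergence of all derivatives)**: for `g ≥ 0`, `ν > ν_c` and every `j`,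
`χ_N^{(j)}(ν) → χ^{(j)}(ν)` as the period `n → ∞` (dominated convergence with `c_{N,T} ≤ c_T`).
[cite: BauerschmidtBrydgesSlade2015LogCorr, Lemma 2.1 ("χ_N and all its derivatives converge … to χ and its derivatives")] -/
theorem tendsto_iteratedDeriv_torusSusceptibility {g : ℝ} (hg : 0 ≤ g) {ν : ℝ}
    (hν : criticalNu d g < ν) (j : ℕ) :
    Tendsto (fun n => iteratedDeriv j (fun ν' => (torusSusceptibility d n g ν').toReal) ν) atTop
      (𝓝 (iteratedDeriv j (fun ν' => (susceptibility d g ν').toReal) ν)) := by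
  simp_rw [iteratedDeriv_torusSusceptibility_toReal _ hg hν, iteratedDeriv_susceptibility_toReal hg hν]
  have h1 : criticalNu d g < (criticalNu d g + ν) / 2 := by linarith
  have h2 : (criticalNu d g + ν) / 2 < ν := by linarith
  exact (tendsto_laplaceMoment (hn := fun n T => (torusSurvival d n g T).toReal)
    (h := fun T => (survival d g T).toReal)
    (fun n => (measurable_torusSurvival d n g).ennreal_toReal) (fun _ _ => ENNReal.toReal_nonneg)
    (fun n T => torusSurvival_toReal_le n hg T) h2 (integrableOn_survival_mul_exp hg h1)
    (fun T _ => tendsto_torusSurvival_toReal hg T) j).const_mul _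

/-- **Lemma 2.1 (`χ_N → χ` as real numbers above `ν_c`)**, the case `j = 0`.
[cite: BauerschmidtBrydgesSlade2015LogCorr, Lemma 2.1 (display `χ(ν) = lim_{N→∞} χ_N(ν)` for Re ν > ν_c)] -/
theorem tendsto_torusSusceptibility_toReal {g : ℝ} (hg : 0 ≤ g) {ν : ℝ} (hν : criticalNu d g < ν) :
    Tendsto (fun n => (torusSusceptibility d n g ν).toReal) atTop
      (𝓝 (susceptibility d g ν).toReal) := by
  simpa using tendsto_iteratedDeriv_torusSusceptibility (d := d) hg hν 0

/-- **Lemma 2.1 (uniformity)**: for `g ≥ 0`, `a > ν_c` and every `j`, `χ_N^{(j)} → χ^{(j)}`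
UNIFORMLY on `[a, ∞)` (the deficits `∫T^j(c_T - c_{N,T})e^{-νT} ≥ 0` decrease in `ν`); in
particular uniformly on compact subsets of `(ν_c, ∞)`.
[cite: BauerschmidtBrydgesSlade2015LogCorr, Lemma 2.1 ("converge uniformly on compact subsets of Re ν > ν_c")] -/
theorem tendstoUniformlyOn_iteratedDeriv_torusSusceptibility {g : ℝ} (hg : 0 ≤ g) {a : ℝ}
    (ha : criticalNu d g < a) (j : ℕ) :
    TendstoUniformlyOn
      (fun n ν => iteratedDeriv j (fun ν' => (torusSusceptibility d n g ν').toReal) ν)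
      (fun ν => iteratedDeriv j (fun ν' => (susceptibility d g ν').toReal) ν) atTop (Ici a) := by
  have h1 : criticalNu d g < (criticalNu d g + a) / 2 := by linarith
  have h2 : (criticalNu d g + a) / 2 < a := by linarith
  have hu := tendstoUniformlyOn_laplaceMoment (hn := fun n T => (torusSurvival d n g T).toReal)
    (h := fun T => (survival d g T).toReal)
    (fun n => (measurable_torusSurvival d n g).ennreal_toReal) (fun _ _ => ENNReal.toReal_nonneg)
    (fun n T => torusSurvival_toReal_le n hg T) (measurable_survival d g).ennreal_toReal h2
    (integrableOn_survival_mul_exp hg h1) (fun T _ => tendsto_torusSurvival_toReal hg T) j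
  rw [Metric.tendstoUniformlyOn_iff] at hu ⊢
  intro ε hε
  filter_upwards [hu ε hε] with n hn ν hν
  have hν' : criticalNu d g < ν := ha.trans_le (mem_Ici.1 hν)
  rw [iteratedDeriv_torusSusceptibility_toReal n hg hν', iteratedDeriv_susceptibility_toReal hg hν',
    Real.dist_eq, ← mul_sub, abs_mul, abs_pow, abs_neg, abs_one, one_pow, one_mul, ← Real.dist_eq]
  exact hn ν hν

/-- The first derivatives, in `HasDerivAt` form: `χ_N'(ν) = -∫₀^∞ T c_{N,T} e^{-νT} dT → χ'(ν)`
(`g ≥ 0`, `ν > ν_c`) — the form in which Lemma 2.1 enters the last display of §4.1 and §8.4 of the source.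
[cite: BauerschmidtBrydgesSlade2015LogCorr, Lemma 2.1 with §4.1 (display ∂χ/∂ν = (1+z₀)² lim_N ∂χ̂_N/∂ν₀)] -/
theorem hasDerivAt_torusSusceptibility_toReal (n : ℕ) {g : ℝ} (hg : 0 ≤ g) {ν : ℝ}
    (hν : criticalNu d g < ν) :
    HasDerivAt (fun ν' => (torusSusceptibility d n g ν').toReal)
      (-∫ T in Ioi (0 : ℝ), T * ((torusSurvival d n g T).toReal * Real.exp (-ν * T))) ν := by
  have hfun : (fun ν' => (torusSusceptibility d n g ν').toReal) =
      fun ν' => ∫ T in Ioi (0 : ℝ), T ^ 0 * ((torusSurvival d n g T).toReal * Real.exp (-ν' * T)) := by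
    funext ν'
    rw [torusSusceptibility_toReal_eq_integral n hg ν']
    simp
  rw [hfun]
  simpa using hasDerivAt_torusSusceptibilityMoment n hg hν 0

/-- `χ_N'(ν) → χ'(ν)` (`g ≥ 0`, `ν > ν_c`). [cite: BauerschmidtBrydgesSlade2015LogCorr, Lemma 2.1 (convergence of derivatives)] -/
theorem tendsto_deriv_torusSusceptibility {g : ℝ} (hg : 0 ≤ g) {ν : ℝ} (hν : criticalNu d g < ν) :
    Tendsto (fun n => deriv (fun ν' => (torusSusceptibility d n g ν').toReal) ν) atTop
      (𝓝 (deriv (fun ν' => (susceptibility d g ν').toReal) ν)) := by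
  simpa using tendsto_iteratedDeriv_torusSusceptibility (d := d) hg hν 1

end CTWSAW

end Literature.Barriers.CriticalPhenomena
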